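import Literature.AlgebraicGeometry.ModuliOfAbelianVarieties.SiegelShimuraSetIndexMultiplier
import HarnessLib

/-!
# Strong approximation for `Sp_δ` in the similitude-group currency: `Sp_δ(𝔸_{ℚ,f}) = Sp_δ(ℚ) · U`

Topic `AlgebraicGeometry/ModuliOfAbelianVarieties`; namespace `Literature.AlgebraicGeometry.ModuliOfAbelianVarieties`.
KERNEL ONLY: theorems, no definition, no named fact, no instance, no `sorry`.  Cell `hodgecm-mathlib`, #60 road
(A-p05 table, item R60-8c): the PLAIN KERNEL FORM of strong approximation for the type-`δ` symplectic group in the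
(σ1)/(σ2) vocabulary of the Siegel modular variety — `gspFinAdelic δ = GSp_δ(𝔸_{ℚ,f}) ≤ GL_{2g}(𝔸_{ℚ,f})` with Mathlib's
units topology, `symplecticGroupOfForm (typeFormOver δ ·) = Sp_δ` (the type-`δ` form `E_δ = (0 Δ; −Δ 0)`),
`gspRationalToFinAdelic` — obtained from the tree's strong approximation theorem for Mathlib's standard symplectic group
(`Literature.NumberTheory.Automorphic.exists_symplecticGroup_map_mul_eq_of_denseRange` /
`symplecticGroup_denseRange_map_finiteAdeleRing`: `Sp_{2g}(ℚ)` is dense in `Sp_{2g}(𝔸_{ℚ,f})` for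
`Matrix.symplecticGroup (Fin g)`, the form `J = (0 −1; 1 0)`) through the rational change of basis `P_δ = diag(1_g, Δ)`
(`SiegelShimuraSetIndexMultiplier.exists_rational_changeOfBasis`, `SymplecticFormTransport`: `Sp(E_δ) = P_δ⁻¹ Sp(J) P_δ`
over `ℚ` and over `𝔸_{ℚ,f}`) and the continuous homomorphism `Sp(J)(𝔸_{ℚ,f}) → GL_{2g}(𝔸_{ℚ,f})`
(`continuous_unitsMap_toUnits`), all consumed BY NAME:

* `exists_gspRational_mul_mem_of_isOpen` — **for `0 < δᵢ`, every open `U ⊆ GSp_δ(𝔸_{ℚ,f})` with `1 ∈ U` and every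
  `a ∈ GSp_δ(𝔸_{ℚ,f})` of multiplier one there is a rational symplectic `γ ∈ Sp_δ(ℚ) ≤ GSp_δ(ℚ)` with `γ⁻¹ a ∈ U`**, i.e.
  `Sp_δ(𝔸_{ℚ,f}) = Sp_δ(ℚ) · U`;
* `exists_gspRational_mul_eq_of_isOpen` — the same for an open subgroup `K ≤ GSp_δ(𝔸_{ℚ,f})`: `a = γ k`, `k ∈ K`
  (e.g. `K = K_δ(N)`, open by the tree's `isOpen_principalLevelSubgroup`).

(`SiegelShimuraSetIndexMultiplier.doubleCosetMk_eq_of_isMultiplier` is the double-coset COROLLARY «common multiplier ⇒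
same class»; the present file records the group-theoretic statement itself, which the one-level dissection
`Sh_{K_δ(N)} ≃ Σ_u Γ_δ(N)∖𝔥_g` with INTEGRAL representatives consumes.)  This is the input
«`G^der(𝔸_f) = G^der(ℚ) · (K ∩ G^der(𝔸_f))`» of the adelic description of the connected components / the finite piece
index of `Sh_K(GSp_δ, 𝔥_g^±)(ℂ) = GSp_δ(ℚ)∖(𝔥_g^± × GSp_δ(𝔸_f)/K)` ([Milne2005ShimuraVarieties] Prop. 4.18 (proof),
Lemma 5.13, (5.2), Thm. 5.17; [Deligne1971TravauxShimura] 2.7 with 4.16).  Banked generic leaf (books 0).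
HC_CM is proved only modulo the 7 printed citations until rung 0 closes.

## References
* [Milne2005ShimuraVarieties] J. S. Milne, *Introduction to Shimura varieties* (2005), §4 Thm. 4.16, Prop. 4.18 p. 48;
  §5 Lemma 5.13 p. 57, Thm. 5.17 p. 59; §6 p. 67.
* [PlatonovRapinchuk1994] V. Platonov, A. Rapinchuk, *Algebraic groups and number theory* (1994), §5.1, §7.4 Thm. 7.12.
* [Deligne1971TravauxShimura] P. Deligne, *Travaux de Shimura* (1971), 1.8, 2.7, 4.16.
-/

set_option autoImplicit false

noncomputable section

open Matrix Topology NumberField IsDedekindDomain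

namespace Literature.AlgebraicGeometry.ModuliOfAbelianVarieties

open Literature.RepresentationTheory.HeisenbergGroup.SymplecticMatrix (mapHom coe_mapHom)
open Literature.NumberTheory.Automorphic (symplecticGroup_denseRange_map_finiteAdeleRing)

variable {g : ℕ} (δ : Fin g → ℕ)

/-- `Q (Q⁻¹ X Q) Q⁻¹ = X` in a group. [folklore] -/
private theorem conj_conj_inv {G : Type*} [Group G] (Q X : G) : Q * (Q⁻¹ * X * Q) * Q⁻¹ = X := by group

/-- **Strong approximation for `Sp_δ` in the tree's similitude currency.**  Let `0 < δᵢ`, let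
`U ⊆ GSp_δ(𝔸_{ℚ,f})` be open (subspace of Mathlib's units topology on `GL_{2g}(𝔸_{ℚ,f})`) with `1 ∈ U`, and let
`a ∈ GSp_δ(𝔸_{ℚ,f})` have multiplier one (`a ∈ Sp_δ(𝔸_{ℚ,f}) = symplecticGroupOfForm (typeFormOver δ 𝔸_{ℚ,f})`).  Then
some RATIONAL symplectic `γ ∈ Sp_δ(ℚ)` has `γ⁻¹ a ∈ U` — `Sp_δ(𝔸_{ℚ,f}) = Sp_δ(ℚ) · U`.  Proof: with the rational
`P_δ` of `exists_rational_changeOfBasis` (`Sp_δ = P_δ⁻¹ Sp_J P_δ` over `ℚ` and over `𝔸_{ℚ,f}`, compatibly with the diagonal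
embedding), `x ↦ P_δ⁻¹ x P_δ : Sp_J(𝔸_{ℚ,f}) → GSp_δ(𝔸_{ℚ,f})` is continuous (`continuous_unitsMap_toUnits`), the set
`{x | (P_δ⁻¹ x P_δ)⁻¹ a ∈ U}` is open and contains `P_δ a P_δ⁻¹`, so it meets the dense image of `Sp_J(ℚ)`
(`symplecticGroup_denseRange_map_finiteAdeleRing`). [cite: Milne2005ShimuraVarieties, §4 Thm. 4.16 and Prop. 4.18 (proof) p. 48]
[cite: PlatonovRapinchuk1994, §7.4 Thm. 7.12] -/
theorem exists_gspRational_mul_mem_of_isOpen (hδ : ∀ i, 0 < δ i) (U : Set (gspFinAdelic δ)) (hU : IsOpen U)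
    (h1 : (1 : gspFinAdelic δ) ∈ U) (a : gspFinAdelic δ)
    (ha : (a : GL (Fin g ⊕ Fin g) finAdeleQ) ∈ symplecticGroupOfForm (typeFormOver δ finAdeleQ)) :
    ∃ γ : gspRational δ, (γ : GL (Fin g ⊕ Fin g) ℚ) ∈ symplecticGroupOfForm (typeFormOver δ ℚ) ∧
      (gspRationalToFinAdelic δ γ)⁻¹ * a ∈ U := by
  classical
  obtain ⟨PQ, hSpQ, hSpA⟩ := exists_rational_changeOfBasis δ hδ
  -- (`PA` is kept OPAQUE — an `obtain`ed variable with its defining equation.)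
  obtain ⟨PA, hPA⟩ : ∃ PA : GL (Fin g ⊕ Fin g) finAdeleQ,
      PA = Matrix.GeneralLinearGroup.map (algebraMap ℚ finAdeleQ) PQ := ⟨_, rfl⟩
  rw [← hPA] at hSpA
  -- the two bridge homomorphisms `Sp(J) →* GL`
  set φA : Matrix.symplecticGroup (Fin g) finAdeleQ →* GL (Fin g ⊕ Fin g) finAdeleQ :=
    (Units.map (Matrix.symplecticGroup (Fin g) finAdeleQ).subtype).comp
      (toUnits (G := Matrix.symplecticGroup (Fin g) finAdeleQ)).toMonoidHom with hφA
  set φQ : Matrix.symplecticGroup (Fin g) ℚ →* GL (Fin g ⊕ Fin g) ℚ :=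
    (Units.map (Matrix.symplecticGroup (Fin g) ℚ).subtype).comp
      (toUnits (G := Matrix.symplecticGroup (Fin g) ℚ)).toMonoidHom with hφQ
  -- membership in `Sp_δ` read through `P_δ`
  have memA : ∀ x : GL (Fin g ⊕ Fin g) finAdeleQ, x ∈ symplecticGroupOfForm (typeFormOver δ finAdeleQ) ↔
      ((PA * x * PA⁻¹ : GL (Fin g ⊕ Fin g) finAdeleQ) : Matrix (Fin g ⊕ Fin g) (Fin g ⊕ Fin g) finAdeleQ) ∈
        Matrix.symplecticGroup (Fin g) finAdeleQ := fun x => by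
    rw [hSpA, mem_map_conj_inv_iff, mem_symplecticGroupOfForm_J_iff]
  have memQ : ∀ x : GL (Fin g ⊕ Fin g) ℚ, x ∈ symplecticGroupOfForm (typeFormOver δ ℚ) ↔
      ((PQ * x * PQ⁻¹ : GL (Fin g ⊕ Fin g) ℚ) : Matrix (Fin g ⊕ Fin g) (Fin g ⊕ Fin g) ℚ) ∈
        Matrix.symplecticGroup (Fin g) ℚ := fun x => by
    rw [hSpQ, mem_map_conj_inv_iff, mem_symplecticGroupOfForm_J_iff]
  -- the continuous map `ψ : Sp_J(𝔸_{ℚ,f}) → GSp_δ(𝔸_{ℚ,f})`, `x ↦ P_δ⁻¹ x P_δ`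
  have hψmem : ∀ x : Matrix.symplecticGroup (Fin g) finAdeleQ, PA⁻¹ * φA x * PA ∈ gspFinAdelic δ := by
    intro x
    refine symplecticGroupOfForm_le_similitudeGroupOfForm _ ((memA _).2 ?_)
    rw [conj_conj_inv, coe_unitsMap_toUnits]
    exact x.2
  let ψ : Matrix.symplecticGroup (Fin g) finAdeleQ → gspFinAdelic δ := fun x => ⟨PA⁻¹ * φA x * PA, hψmem x⟩
  have hψc : Continuous ψ :=
    Continuous.subtype_mk ((continuous_const.mul continuous_unitsMap_toUnits).mul continuous_const) _
  -- the non-empty open subset `{x | ψ(x)⁻¹ a ∈ U}` of `Sp_J(𝔸_{ℚ,f})`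
  have hO : IsOpen {x : Matrix.symplecticGroup (Fin g) finAdeleQ | (ψ x)⁻¹ * a ∈ U} :=
    hU.preimage (hψc.inv.mul continuous_const)
  have hx₀ : ((PA * (a : GL (Fin g ⊕ Fin g) finAdeleQ) * PA⁻¹ : GL (Fin g ⊕ Fin g) finAdeleQ) :
      Matrix (Fin g ⊕ Fin g) (Fin g ⊕ Fin g) finAdeleQ) ∈ Matrix.symplecticGroup (Fin g) finAdeleQ := (memA _).1 ha
  have hψx₀ : ψ ⟨_, hx₀⟩ = a := by
    apply Subtype.ext
    change PA⁻¹ * φA ⟨_, hx₀⟩ * PA = (a : GL (Fin g ⊕ Fin g) finAdeleQ)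
    have hφ : φA ⟨_, hx₀⟩ = PA * (a : GL (Fin g ⊕ Fin g) finAdeleQ) * PA⁻¹ := Units.ext rfl
    rw [hφ]
    group
  obtain ⟨γ', hγ'⟩ := (symplecticGroup_denseRange_map_finiteAdeleRing (𝓞 ℚ) ℚ).exists_mem_open hO
    ⟨⟨_, hx₀⟩, by
      change (ψ ⟨_, hx₀⟩)⁻¹ * a ∈ U
      rw [hψx₀, inv_mul_cancel]
      exact h1⟩
  -- the rational element `γ = P_δ⁻¹ γ' P_δ`
  have hγsp : PQ⁻¹ * φQ γ' * PQ ∈ symplecticGroupOfForm (typeFormOver δ ℚ) := by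
    refine (memQ _).2 ?_
    rw [conj_conj_inv, coe_unitsMap_toUnits]
    exact γ'.2
  refine ⟨⟨_, symplecticGroupOfForm_le_similitudeGroupOfForm _ hγsp⟩, hγsp, ?_⟩
  have hmap : gspRationalToFinAdelic δ ⟨_, symplecticGroupOfForm_le_similitudeGroupOfForm _ hγsp⟩ =
      ψ (mapHom (algebraMap ℚ finAdeleQ) γ') := by
    apply Subtype.ext
    rw [coe_gspRationalToFinAdelic]
    change Matrix.GeneralLinearGroup.map (algebraMap ℚ finAdeleQ) (PQ⁻¹ * φQ γ' * PQ) =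
      PA⁻¹ * φA (mapHom (algebraMap ℚ finAdeleQ) γ') * PA
    rw [map_mul, map_mul, map_inv, hPA, hφQ, generalLinearGroup_map_unitsMap_toUnits]
  change (gspRationalToFinAdelic δ ⟨_, symplecticGroupOfForm_le_similitudeGroupOfForm _ hγsp⟩)⁻¹ * a ∈ U
  rw [hmap]
  exact hγ'

/-- **`Sp_δ(𝔸_{ℚ,f}) = Sp_δ(ℚ) · K` for every OPEN SUBGROUP `K ≤ GSp_δ(𝔸_{ℚ,f})`** (`0 < δᵢ`; e.g. the principal levels
`K_δ(N)`, open by `isOpen_principalLevelSubgroup`): every `a ∈ GSp_δ(𝔸_{ℚ,f})` of multiplier one is `γ k` with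
`γ ∈ Sp_δ(ℚ)` rational symplectic and `k ∈ K` — the representative step of [Milne2005ShimuraVarieties] Lemma 5.13 /
Thm. 5.17 for `G^der = Sp_δ`. [cite: Milne2005ShimuraVarieties, §5 Lemma 5.13 p. 57 and Thm. 5.17 p. 59]
[cite: PlatonovRapinchuk1994, §7.4 Thm. 7.12] -/
theorem exists_gspRational_mul_eq_of_isOpen (hδ : ∀ i, 0 < δ i) (K : Subgroup (gspFinAdelic δ))
    (hK : IsOpen (K : Set (gspFinAdelic δ))) (a : gspFinAdelic δ)
    (ha : (a : GL (Fin g ⊕ Fin g) finAdeleQ) ∈ symplecticGroupOfForm (typeFormOver δ finAdeleQ)) :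
    ∃ γ : gspRational δ, (γ : GL (Fin g ⊕ Fin g) ℚ) ∈ symplecticGroupOfForm (typeFormOver δ ℚ) ∧
      ∃ k ∈ K, a = gspRationalToFinAdelic δ γ * k := by
  obtain ⟨γ, hγ, hmem⟩ := exists_gspRational_mul_mem_of_isOpen δ hδ K hK K.one_mem a ha
  exact ⟨γ, hγ, _, hmem, (mul_inv_cancel_left _ _).symm⟩

end Literature.AlgebraicGeometry.ModuliOfAbelianVarieties

end
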